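import Mathlib
import Literature.NumberTheory.LFunctions.WeilExplicit
import Literature.NumberTheory.LFunctions.ZetaZerosProofs
import Literature.NumberTheory.LFunctions.ZetaZerosReflection
import HarnessLib

/-!
# Bombieri's finite truncations of Weil's quadratic form: Theorems 8, 9, 11 and the Corollary, as printed

Source: E. Bombieri, *Remarks on Weil's quadratic functional in the theory of prime numbers, I*,
Atti Accad. Naz. Lincei, Rend. Lincei (9) Mat. Appl. **11** (2000), no. 3, 183–233 [Bombieri2000Weil]
("Pervenuta il 15 giugno 2000, in forma definitiva il 7 settembre 2000"). Locators are Bombieri's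
section / theorem / equation numbers (§7 begins on p. 203, (7.13) is on p. 207; §§8–11 occupy the pages
that follow, §13 "Some numerical experiments" and the bibliography ending on p. 233).

This file TYPES, as cited named facts (no proofs), the four statements of §§8–11 that the tree did not
have: the negative-eigenvalue counts of the finite truncations (Theorems 8 and 9) and the "finitely many
off-line zeros" alternative (Theorem 11 and its Corollary). Everything else of the memoir that the tree
uses is elsewhere: Theorems 1–2 (`weil_criterion_holds`, `explicit_formula_holds`), §4 Problem 2
(`weilGroundEnergy`), Theorems 3/5 in the odd sector (`WeilOddGroundState*.lean`,
`WeilWindowSuzukiContinuityProofs.lean`), Theorem 12 PROVED (`Bombieri2000Thm12_holds`).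

## The printed objects (§§7–9, §11)

* §7 (p. 203): `ρ = 1/2 + iγ`, `M = e^t` (`t > 0`), `K(x) = sin x / x`,
  `K*(x, y, t) = K(t(x−y)) − (t/sinh t)(1/2 + iy) K(t(i/2 − y)) K(t(i/2 + x))
  − (t/sinh t)(1/2 − iy) K(t(i/2 + y)) K(t(i/2 − x))`, (7.3) `H(x, y, t) = 2t K*(x, y, t)/(1/4 + y²)`,
  `ℋ(Γ; t) = [H(γ, γ', t)]_{γ, γ' ∈ Γ}`. In §8 (proof of Lemma 10) the same kernel is displayed as
  `(1/4 + y²) H(x, y, t) = ∫_{−t}^{t} e^{ixu} e^{−iyu} du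
   − (e^{(1/2−iy)t} − e^{−(1/2−iy)t})/(e^t − e^{−t}) · (e^{(1/2+ix)t} − e^{−(1/2+ix)t})/(1/2 + ix)
   − (e^{(1/2+iy)t} − e^{−(1/2+iy)t})/(e^t − e^{−t}) · (e^{(1/2−ix)t} − e^{−(1/2−ix)t})/(1/2 − ix)`;
  we take THIS closed form as the body of `Bombieri2000.H` (no `sin z / z` with a removable singularity;
  the two agree by (7.1) wherever `x, y ≠ ±i/2`).
* §8: "Let `𝒵` be a finite multiset of complex numbers, repeated according to their multiplicity. We
  assume that if `ρ ∈ 𝒵` then `ρ̄` and `1 − ρ` are again elements of `𝒵`, with the same multiplicity as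
  `ρ`. For `ρ ∈ 𝒵` we write `ρ = 1/2 + iγ` and denote by `Γ` the corresponding set of points `γ`." In the
  variable `γ` the two symmetries are `γ ↦ −γ̄` and `γ ↦ −γ` (so also `γ ↦ γ̄`); `γ ∈ ℝ ⇔ Re ρ = 1/2`.
  A finite multiset is presented here as a family `γ : ι → ℂ` on a `Fintype` (repetitions allowed);
  invariance "with multiplicity" under a map `f` is `∃ σ : Equiv.Perm ι, γ ∘ σ = f ∘ γ`
  (`Bombieri2000.FamilyInvariant`).
* §9: (9.1) `λ z_γ = Σ_{γ'} (∫_E e^{i(γ−γ')u} du) z_{γ'}`, `E` "a finite union of bounded closed intervals",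
  its matrix `𝒦_E(Γ)` (named in Lemma 12); `E` symmetric: `E = −E` (9.2); (9.6)
  `K_E^±(x, y) = ∫_E e^{i(x−y)u} du ± ∫_E e^{i(x+y)u} du`; (9.7)
  `Γ₀ = {γ ∈ Γ : Re γ > 0} ∪ {γ ∈ Γ : Re γ = 0, Im γ > 0}`; `𝒦_E^±(Γ) = [K_E^±(γ, γ')]_{γ, γ' ∈ Γ₀}`
  (Lemma 12, "suppose for simplicity that `0 ∉ Γ`"; REMARK: for `0 ∈ Γ` the `+` matrix is to be modified).
* §10–11: `Γ` = the multiset of the `γ`, `ρ = 1/2 + iγ` running over the non-trivial zeros of `ζ` with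
  multiplicity; `Γ_N = Γ ∩ {|γ| ≤ N}`; (11.2) `λ z_γ = Σ_{γ'∈Γ} z_{γ'} ∫_E e^{iγu} e^{−iγ'u} du`;
  (11.3) `λ Σ_γ z_γ \overline{z_{γ̄}} = ∫_E |F(u)|² du`.

## The printed statements vendored here (FOUR named facts; net debt +4, declared)

**Theorem 8** (§8). "The number of negative eigenvalues of the matrix `ℋ(Γ; t)` equals the number of
distinct complex conjugate pairs `(γ, γ̄)` in `Γ`." — `Bombieri2000.theorem8`.

**Theorem 9** (§9). "Let `E` be a finite union of bounded closed intervals. Then the number of negative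
eigenvalues of `𝒦_E(Γ)` equals the number of distinct complex conjugate pairs `{γ, γ̄}` in `Γ`.
Suppose also that `E` is symmetric. Then the number of negative eigenvalues of `𝒦_E^+(Γ)` equals the
number of distinct complex conjugate pairs `(γ, γ̄)` with `Re(γ) > 0`, and the number of negative
eigenvalues of `𝒦_E^−(Γ)` equals the number of distinct complex conjugate pairs `(γ, γ̄)` with
`Re(γ) ≥ 0`." — `Bombieri2000.theorem9` (both parts, one conjunction).

**Theorem 11** (§11). "Suppose that `ζ(s)` has only finitely many non-trivial zeros `1/2 + iγ` with
`γ ∉ ℝ`, and at least one such zero. Then for any finite union of intervals `E` there are complex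
coefficients `z_γ = z_γ(E)` and `λ = λ(E) ≤ 0` such that `Σ_{γ∈Γ} |z_γ|² = 1`,
`Σ_{γ∉ℝ} |z_γ|² ≥ −Σ_{γ∉ℝ} z_γ \overline{(z_{γ̄})} ≥ 1/2` and with the following property. Let
`F(u) = Σ_γ z_γ e^{−iγu}`. Then `F(u)` is locally in `L²` and `λ z_γ = ∫_E e^{iγu} F(u) du` for every
`γ ∈ Γ`. Moreover, if `f(x) = φ(x) x^{−1/2} F(log x)` where `φ(x)` is the characteristic function of
`𝓔 = e^{E}`, we have either `𝒯[f * f̄*] = λ ‖f‖² < 0` or `λ = 0` and `f(x)` is identically `0`."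
— `Bombieri2000.theorem11`.

**Corollary** (§11, after Theorem 11). "Let `𝓔 ⊂ (0, ∞)` be a finite union of bounded closed intervals
and suppose that `𝒯[f * f̄*] ≥ 0` for every smooth function `f` with compact support in `𝓔`. Then either
the Riemann Hypothesis is true, or `ζ(s)` has infinitely many zeros off the critical line, or the
functions `x^{−ρ}` are linearly dependent over `𝓔`, for a suitable sequence of coefficients `{c_ρ} ∈ ℓ²`
such that at least half of its `ℓ²`-mass is supported on the set of zeros `ρ` with `Re(ρ) ≠ 1/2`."
— `Bombieri2000.corollary11`.

## Dictionary and typing decisions (read before using the facts)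

* "Number of negative eigenvalues" of a complex square matrix `M` = number of roots of the
  characteristic polynomial that are real and negative, counted with algebraic multiplicity
  (`Bombieri2000.negEigenvalueCount`; the matrices are not hermitian — their spectrum is real by
  Lemma 9 / Lemma 12, which is part of the content). "Number of distinct complex conjugate pairs
  `(γ, γ̄)` in `Γ`" = number of distinct values `γ` of the family with `Im γ > 0`
  (`Bombieri2000.conjPairCount`; under `Γ̄ = Γ` the non-real values pair off as `(γ, γ̄)` with exactly
  one member in the upper half-plane); "with `Re γ > 0`" / "`Re γ ≥ 0`" filter on the real part
  (`conjPairCountRe`).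
* Theorem 8 is typed with the explicit proviso `γ ≠ ±i/2` for all `γ ∈ Γ` (i.e. `ρ ≠ 0, 1`): the printed
  kernel `H(x, y, t)` has removable singularities there ((7.3) divides by `1/4 + y²`, the §8 form by
  `1/2 ± ix`), Bombieri's `𝒵` models "the complex zeros of `ζ`" (§6 (6.1)) for which this holds, and the
  boundary functions `e^{±u/2}` of (8.15) are `e^{−iγu}` exactly at `γ = ±i/2`. This is a restriction
  of the Lean statement, not a strengthening.
* "Finite union of bounded closed intervals" (`Bombieri2000.IsFiniteUnionOfIntervals`): a non-empty
  finite union of non-degenerate intervals `[a, b]`, `a < b` (for a null set `E` the matrix `𝒦_E(Γ)`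
  vanishes and Theorem 9 would fail trivially; §11 l. 1 even says "disjoint", which does not change the
  set). For the Corollary, `𝓔 ⊂ (0, ∞)`: additionally `0 < a`.
* The second part of Theorem 9 is typed under Lemma 12's standing simplification `0 ∉ Γ` (the printed
  REMARK after Lemma 12 says the result persists for `0 ∈ Γ` after modifying `𝒦_E^+(Γ)` by the term
  `½ K_E^+(γ, 0) z₀` of (9.8); that modified matrix is not typed).
* §§10–11, `ζ`: Bombieri's `Γ` is a MULTISET (footnotes (7), (8): "each term appears according to its
  proper multiplicity"). The index type `Bombieri2000.ZeroIdx` is therefore the type of pairs `(ρ, k)`,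
  `ρ` a non-trivial zero (`ZetaZeros.riemannZetaNontrivialZeros`), `k < m(ρ) = riemannZetaZeroOrder ρ`;
  `γ̄` is the index-level reflection `(ρ, k) ↦ (1 − ρ̄, k)` (`ZeroIdx.bar`, well defined by
  `riemannZetaZeroOrder_one_sub_conj`); `γ ∉ ℝ` is `Re ρ ≠ 1/2`; `Γ_N` is `‖ρ − 1/2‖ ≤ N` (`= |γ|`);
  `e^{−iγu} = e^{(1/2 − ρ)u}`, `e^{iγu} = e^{(ρ − 1/2)u}`.
* "`F(u) = Σ_γ z_γ e^{−iγu}` … is locally in `L²` and `λ z_γ = ∫_E e^{iγu} F(u) du`": the series over all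
  zeros with `ℓ²` coefficients has no pointwise or norm meaning in general; the sense ESTABLISHED in §11
  (p. of (11.2)–(11.5): "`F` exists as an `L²`-function and is a weak limit", "(11.2) continues to remain
  true in the limit … `λ z_γ = Σ_{γ'} z_{γ'} ∫_E e^{iγu} e^{−iγ'u} du` for every `γ`, as asserted. This
  equation can be rewritten as `∫_E e^{iγu} F(u) du = λ z_γ`") is typed verbatim: `F ∈ L²(E)`,
  `λ z_γ = ∫_E e^{iγu} F`, AND `λ z_γ = lim_{N→∞} Σ_{γ'∈Γ_N} z_{γ'} ∫_E e^{iγu} e^{−iγ'u} du` for every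
  `γ ∈ Γ` (so `F` sums the series weakly against the exponentials `e^{iγu}`, `γ ∈ Γ`, on `E`). With
  `λ = 0` the last clause is the non-trivial relation `Σ_{γ'} K_E(γ, γ') z_{γ'} = 0`; this is the
  reading of "the functions `x^{−ρ}` are linearly dependent over `𝓔`" in the Corollary
  (`Bombieri2000.XPowLinDepOn`: in the variable `x = e^u`, `Σ_{ρ'} c_{ρ'} ∫_𝓔 x^{−ρ'} \overline{x^{−ρ}} dx
  = 0` for every zero `ρ`, the series over `‖ρ' − 1/2‖ ≤ N → ∞` converging — Bombieri, after the
  Corollary: "the coefficients of the relations in question are obtained as limits of eigenvectors of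
  reasonably well-behaved matrices").
* `𝒯[f * f̄*]` and `‖f‖`: with `g(u) = e^{u/2} f(e^u)` (the dictionary of `WeilExplicit.lean`; it is
  unitary `L²((0,∞), dx) → L²(ℝ, du)`), Bombieri's `f = φ·x^{−1/2} F(log x)` is `g = 𝟙_E · F` and
  `𝒯[f * f̄*] = weilQuadratic g`, `‖f‖² = ∫_E |F|²`. As in `Yoshida1992.theorem1`, `weilQuadratic` is
  applied to a function with jumps (for `λ < 0` the eigenfunction `F` is smooth on each interval by
  (11.1) and `|ĝ(1/2+it)|² = O(t^{−2})` makes the archimedean integral absolutely convergent); the fact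
  only STATES the printed identity. "Smooth `f` with compact support in `𝓔`" ↦
  `IsWeilTest g ∧ tsupport g ⊆ log 𝓔` (as `WeilPositivityOn a` renders `supp f ⊆ [M⁻¹, M]`, §3).
* Mathlib's `RiemannHypothesis` is the tree's summit statement (`weil_criterion_holds : RiemannHypothesis ↔
  WeilPositivity`); "infinitely many zeros off the critical line" ↦
  `{ρ ∈ riemannZetaNontrivialZeros | Re ρ ≠ 1/2}.Infinite`.

## What is deliberately NOT here

* No proofs: Theorems 8/9 are finite-dimensional (a route: by (8.14)/(11.3) the matrices are
  self-adjoint and non-negative for the indefinite hermitian form `Σ_γ z_γ \overline{w_{γ̄}}`, whose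
  negative index of inertia is the number of conjugate pairs — Sylvester's law of inertia for the
  hermitian pencil then gives the count; Mathlib has no inertia theorem today); Theorem 11 is §§10–11.
* Theorem 10 (§10, the `W₀^{1,2}` analogue of Theorem 11 with `ℋ(Γ; t)`), Lemmas 8–14, Theorem 6–7
  (the Fredholm resolvent), the Example after the Corollary (linear relations for Dedekind zeta
  functions) and §13 are not typed. For a SINGLE interval `E = [−a, a]` the tree proves the sharper
  dichotomy `riemannHypothesis_or_exists_threshold` (`YoshidaPositivityThreshold.lean`).
-/

noncomputable section

open Complex Set MeasureTheory Filter
open scoped Real Topology ComplexConjugate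

namespace Literature.NumberTheory.LFunctions

namespace Bombieri2000

/-! ## §1 Counting devices -/

/-- The number of negative eigenvalues of a complex square matrix: roots of the characteristic
polynomial which are real and negative, counted with (algebraic) multiplicity (§8: "the number of
negative eigenvalues of the matrix `ℋ(Γ; t)`"; the eigenvalues in question are real by Lemma 9). [cite: Bombieri2000Weil, §8 Theorem 8] -/
def negEigenvalueCount {ι : Type*} [Fintype ι] [DecidableEq ι] (M : Matrix ι ι ℂ) : ℕ :=
  M.charpoly.roots.countP fun z ↦ z.im = 0 ∧ z.re < 0

/-- A finite multiset of complex numbers, presented as a family `γ : ι → ℂ` with repetitions, is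
invariant WITH MULTIPLICITY under `f : ℂ → ℂ`: some permutation of the index set realises `f`
(§8: "if `ρ ∈ 𝒵` then `ρ̄` and `1 − ρ` are again elements of `𝒵`, with the same multiplicity"). [cite: Bombieri2000Weil, §8 (standing assumptions)] -/
def FamilyInvariant {ι : Type*} (γ : ι → ℂ) (f : ℂ → ℂ) : Prop :=
  ∃ σ : Equiv.Perm ι, ∀ i, γ (σ i) = f (γ i)

open scoped Classical in
/-- "The number of distinct complex conjugate pairs `(γ, γ̄)` in `Γ`": the number of distinct
values of the family in the open upper half-plane (each non-real pair `(γ, γ̄)` of a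
conjugation-invariant multiset has exactly one member with `Im γ > 0`). [cite: Bombieri2000Weil, §8 Theorem 8] -/
def conjPairCount {ι : Type*} [Fintype ι] (γ : ι → ℂ) : ℕ :=
  ((Finset.univ.image γ).filter fun z ↦ 0 < z.im).card

open scoped Classical in
/-- "The number of distinct complex conjugate pairs `(γ, γ̄)` with `Re γ` satisfying `p`" (Theorem 9:
`p = (0 < ·)` for `𝒦_E^+`, `p = (0 ≤ ·)` for `𝒦_E^−`; `γ` and `γ̄` have the same real part). [cite: Bombieri2000Weil, §9 Theorem 9] -/
def conjPairCountRe {ι : Type*} [Fintype ι] (γ : ι → ℂ) (p : ℝ → Prop) : ℕ :=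
  ((Finset.univ.image γ).filter fun z ↦ 0 < z.im ∧ p z.re).card

/-! ## §2 The kernel `H(x, y, t)` and the matrix `ℋ(Γ; t)` (§7 (7.3), §8) -/

/-- `e^{st} − e^{−st}` (`= 2 sinh(st)`), the building block of the §8 closed form of `H`. [cite: Bombieri2000Weil, §8 (proof of Lemma 10)] -/
def expDiff (t : ℝ) (s : ℂ) : ℂ :=
  cexp (s * t) - cexp (-(s * t))

/-- Bombieri's kernel `H(x, y, t)` ((7.3): `2t K*(x, y, t)/(1/4 + y²)`), with the body taken from the
closed form displayed in the proof of Lemma 10 (§8):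
`H(x, y, t) = [∫_{−t}^{t} e^{ixu} e^{−iyu} du − (E(1/2−iy)/E(1))·E(1/2+ix)/(1/2+ix)
 − (E(1/2+iy)/E(1))·E(1/2−ix)/(1/2−ix)] / (1/4 + y²)`, `E(s) = e^{st} − e^{−st}`. Junk (division
by zero) only at `y = ±i/2` or `x = ±i/2`, excluded in `theorem8`. [cite: Bombieri2000Weil, §7 (7.3) and §8 (proof of Lemma 10)] -/
def H (t : ℝ) (x y : ℂ) : ℂ :=
  ((∫ u in (-t)..t, cexp (I * x * u) * cexp (-(I * y * u))) -
      expDiff t (1 / 2 - I * y) / expDiff t 1 * (expDiff t (1 / 2 + I * x) / (1 / 2 + I * x)) -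
      expDiff t (1 / 2 + I * y) / expDiff t 1 * (expDiff t (1 / 2 - I * x) / (1 / 2 - I * x))) /
    (1 / 4 + y ^ 2)

/-- The matrix `ℋ(Γ; t) = [H(γ, γ', t)]_{γ, γ' ∈ Γ}` of a finite multiset `Γ` (§7, after (7.4)). [cite: Bombieri2000Weil, §7 (7.4)–(7.5)] -/
def HMat (t : ℝ) {ι : Type*} (γ : ι → ℂ) : Matrix ι ι ℂ :=
  Matrix.of fun i j ↦ H t (γ i) (γ j)

/-- Entries of `ℋ(Γ; t)`. [cite: Bombieri2000Weil, §7 (7.4)–(7.5)] -/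
@[simp] theorem HMat_apply (t : ℝ) {ι : Type*} (γ : ι → ℂ) (i j : ι) :
    HMat t γ i j = H t (γ i) (γ j) := rfl

/-! ## §3 Theorem 8 -/

/-- **Bombieri 2000, Theorem 8** (§8): "The number of negative eigenvalues of the matrix `ℋ(Γ; t)`
equals the number of distinct complex conjugate pairs `(γ, γ̄)` in `Γ`." Here `t > 0` (`M = e^t`, §7),
`Γ` is a finite multiset of complex numbers invariant with multiplicity under `γ ↦ γ̄` and `γ ↦ −γ`
(§8, the symmetries `ρ ↦ ρ̄`, `ρ ↦ 1 − ρ` of `ρ = 1/2 + iγ`), and — made explicit — `γ ≠ ±i/2`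
(`ρ ≠ 0, 1`; see the module docstring). Users take `(h : theorem8)`. [cite: Bombieri2000Weil, §8 Theorem 8] -/
def theorem8 : Prop :=
  ∀ (t : ℝ), 0 < t → ∀ (ι : Type) [Fintype ι] [DecidableEq ι] (γ : ι → ℂ),
    FamilyInvariant γ (starRingEnd ℂ) → FamilyInvariant γ (fun z ↦ -z) →
    (∀ i, γ i ≠ I / 2 ∧ γ i ≠ -(I / 2)) →
      negEigenvalueCount (HMat t γ) = conjPairCount γ

/-! ## §4 The matrices `𝒦_E(Γ)`, `𝒦_E^±(Γ)` and Theorem 9 (§9) -/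

/-- "`E` is a finite union of bounded closed intervals" (§9, §11): a non-empty finite union of
non-degenerate intervals `[a, b]`, `a < b` (see the module docstring for this reading). [cite: Bombieri2000Weil, §9 (before (9.2)) and §11] -/
def IsFiniteUnionOfIntervals (E : Set ℝ) : Prop :=
  ∃ s : Finset (ℝ × ℝ), s.Nonempty ∧ (∀ p ∈ s, p.1 < p.2) ∧ E = ⋃ p ∈ s, Icc p.1 p.2

/-- "`E` is symmetric": `E = −E` ((9.2)). [cite: Bombieri2000Weil, §9 (9.2)] -/
def IsSymmetricSet (E : Set ℝ) : Prop :=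
  ∀ u, u ∈ E ↔ -u ∈ E

/-- The kernel of the second eigenvalue problem (9.1): `K_E(x, y) = ∫_E e^{i(x−y)u} du`. [cite: Bombieri2000Weil, §9 (9.1)] -/
def KE (E : Set ℝ) (x y : ℂ) : ℂ :=
  ∫ u in E, cexp (I * (x - y) * u)

/-- The even/odd kernels (9.6): `K_E^±(x, y) = ∫_E e^{i(x−y)u} du ± ∫_E e^{i(x+y)u} du`
(`s = 1` for `+`, `s = −1` for `−`). [cite: Bombieri2000Weil, §9 (9.6)] -/
def KEpm (s : ℂ) (E : Set ℝ) (x y : ℂ) : ℂ :=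
  KE E x y + s * ∫ u in E, cexp (I * (x + y) * u)

/-- The matrix `𝒦_E(Γ) = [K_E(γ, γ')]_{γ, γ' ∈ Γ}` of (9.1) (so named in Lemma 12). [cite: Bombieri2000Weil, §9 (9.1) and Lemma 12] -/
def KMat (E : Set ℝ) {ι : Type*} (γ : ι → ℂ) : Matrix ι ι ℂ :=
  Matrix.of fun i j ↦ KE E (γ i) (γ j)

/-- Entries of `𝒦_E(Γ)`. [cite: Bombieri2000Weil, §9 (9.1)] -/
@[simp] theorem KMat_apply (E : Set ℝ) {ι : Type*} (γ : ι → ℂ) (i j : ι) :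
    KMat E γ i j = KE E (γ i) (γ j) := rfl

/-- Bombieri's half index set (9.7): `Γ₀ = {γ ∈ Γ : Re γ > 0} ∪ {γ ∈ Γ : Re γ = 0, Im γ > 0}`, as a
predicate on `ℂ` (so `Γ ∖ {0} = Γ₀ ∪ −Γ₀`). [cite: Bombieri2000Weil, §9 (9.7)] -/
def InGammaZero (z : ℂ) : Prop :=
  0 < z.re ∨ (z.re = 0 ∧ 0 < z.im)

/-- The matrices `𝒦_E^±(Γ) = [K_E^±(γ, γ')]_{γ, γ' ∈ Γ₀}` of Lemma 12, indexed by the slots of the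
family lying in `Γ₀` (`s = ±1`). [cite: Bombieri2000Weil, §9 Lemma 12] -/
def KMatPM (s : ℂ) (E : Set ℝ) {ι : Type*} (γ : ι → ℂ) :
    Matrix {i : ι // InGammaZero (γ i)} {i : ι // InGammaZero (γ i)} ℂ :=
  Matrix.of fun i j ↦ KEpm s E (γ i.1) (γ j.1)

open scoped Classical in
/-- **Bombieri 2000, Theorem 9** (§9): "Let `E` be a finite union of bounded closed intervals. Then the
number of negative eigenvalues of `𝒦_E(Γ)` equals the number of distinct complex conjugate pairs
`{γ, γ̄}` in `Γ`. Suppose also that `E` is symmetric. Then the number of negative eigenvalues of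
`𝒦_E^+(Γ)` equals the number of distinct complex conjugate pairs `(γ, γ̄)` with `Re(γ) > 0`, and the
number of negative eigenvalues of `𝒦_E^−(Γ)` equals the number of distinct complex conjugate pairs
`(γ, γ̄)` with `Re(γ) ≥ 0`." `Γ` is a finite multiset with the standing symmetries of §8 (`γ ↦ γ̄`,
`γ ↦ −γ`, with multiplicity); the second part carries Lemma 12's proviso `0 ∉ Γ` (module docstring).
Users take `(h : theorem9)`. [cite: Bombieri2000Weil, §9 Theorem 9] -/
def theorem9 : Prop :=
  ∀ (E : Set ℝ), IsFiniteUnionOfIntervals E →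
    ∀ (ι : Type) [Fintype ι] [DecidableEq ι] (γ : ι → ℂ),
      FamilyInvariant γ (starRingEnd ℂ) → FamilyInvariant γ (fun z ↦ -z) →
      negEigenvalueCount (KMat E γ) = conjPairCount γ ∧
        (IsSymmetricSet E → (∀ i, γ i ≠ 0) →
          negEigenvalueCount (KMatPM 1 E γ) = conjPairCountRe γ (fun r ↦ 0 < r) ∧
            negEigenvalueCount (KMatPM (-1) E γ) = conjPairCountRe γ (fun r ↦ 0 ≤ r))

/-- First part of Theorem 9 (general `E`). [cite: Bombieri2000Weil, §9 Theorem 9] -/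
theorem theorem9.general (h : theorem9) {E : Set ℝ} (hE : IsFiniteUnionOfIntervals E)
    {ι : Type} [Fintype ι] [DecidableEq ι] (γ : ι → ℂ) (hc : FamilyInvariant γ (starRingEnd ℂ))
    (hn : FamilyInvariant γ (fun z ↦ -z)) :
    negEigenvalueCount (KMat E γ) = conjPairCount γ :=
  (h E hE ι γ hc hn).1

open scoped Classical in
/-- Second part of Theorem 9, even sector: for symmetric `E` and `0 ∉ Γ`, the negative eigenvalues of
`𝒦_E^+(Γ)` are counted by the conjugate pairs with `Re γ > 0`. [cite: Bombieri2000Weil, §9 Theorem 9] -/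
theorem theorem9.even (h : theorem9) {E : Set ℝ} (hE : IsFiniteUnionOfIntervals E)
    (hs : IsSymmetricSet E) {ι : Type} [Fintype ι] [DecidableEq ι] (γ : ι → ℂ)
    (hc : FamilyInvariant γ (starRingEnd ℂ)) (hn : FamilyInvariant γ (fun z ↦ -z))
    (h0 : ∀ i, γ i ≠ 0) :
    negEigenvalueCount (KMatPM 1 E γ) = conjPairCountRe γ (fun r ↦ 0 < r) :=
  ((h E hE ι γ hc hn).2 hs h0).1

open scoped Classical in
/-- Second part of Theorem 9, odd sector: for symmetric `E` and `0 ∉ Γ`, the negative eigenvalues of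
`𝒦_E^−(Γ)` are counted by the conjugate pairs with `Re γ ≥ 0` (the purely imaginary pairs `(ib, −ib)`
land in the odd sector). [cite: Bombieri2000Weil, §9 Theorem 9] -/
theorem theorem9.odd (h : theorem9) {E : Set ℝ} (hE : IsFiniteUnionOfIntervals E)
    (hs : IsSymmetricSet E) {ι : Type} [Fintype ι] [DecidableEq ι] (γ : ι → ℂ)
    (hc : FamilyInvariant γ (starRingEnd ℂ)) (hn : FamilyInvariant γ (fun z ↦ -z))
    (h0 : ∀ i, γ i ≠ 0) :
    negEigenvalueCount (KMatPM (-1) E γ) = conjPairCountRe γ (fun r ↦ 0 ≤ r) :=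
  ((h E hE ι γ hc hn).2 hs h0).2

/-! ## §5 The multiset `Γ` of `ζ` with multiplicity (§§10–11) -/

/-- Bombieri's multiset `Γ` for `ζ` (§10: "an infinite multiset of complex numbers"; §6 (6.1): "the sum
runs over all complex zeros `ρ` of `ζ(s)`, repeated according to their multiplicity `m(ρ)`"): an index
is a pair `(ρ, k)` with `ρ` a non-trivial zero and `k < m(ρ) = riemannZetaZeroOrder ρ`. [cite: Bombieri2000Weil, §10 (standing assumptions) and §6 (6.1)] -/
def ZeroIdx : Type :=
  Σ ρ : ZetaZeros.riemannZetaNontrivialZeros, Fin (riemannZetaZeroOrder (ρ : ℂ)).toNat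

namespace ZeroIdx

/-- The zero `ρ` carried by an index slot. [cite: Bombieri2000Weil, §10] -/
def val (i : ZeroIdx) : ℂ := (i.1 : ℂ)

/-- The slot's zero is a non-trivial zero of `ζ`. [cite: Bombieri2000Weil, §10] -/
theorem val_mem (i : ZeroIdx) : i.val ∈ ZetaZeros.riemannZetaNontrivialZeros := i.1.2

/-- `γ = (ρ − 1/2)/i`, Bombieri's variable (`ρ = 1/2 + iγ`, §7). [cite: Bombieri2000Weil, §7] -/
def gamma (i : ZeroIdx) : ℂ := -I * (i.val - 1 / 2)

/-- `ρ = 1/2 + iγ`. [cite: Bombieri2000Weil, §7] -/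
theorem val_eq_gamma (i : ZeroIdx) : i.val = 1 / 2 + I * i.gamma := by
  have h : I * I = -1 := Complex.I_mul_I
  simp only [gamma]
  linear_combination (i.val - 1 / 2) * h

/-- "`γ ∉ ℝ`": the slot's zero is off the critical line. [cite: Bombieri2000Weil, §10–11] -/
def OffLine (i : ZeroIdx) : Prop := i.val.re ≠ 1 / 2

/-- A non-trivial zero lies in the open critical strip (`mem_riemannZetaNontrivialZeros_iff_holds`). [cite: Bombieri2000Weil, §10] -/
theorem re_pos_and_lt_one (i : ZeroIdx) : 0 < i.val.re ∧ i.val.re < 1 :=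
  ⟨(mem_riemannZetaNontrivialZeros_iff_holds.1 i.val_mem).2.1,
    (mem_riemannZetaNontrivialZeros_iff_holds.1 i.val_mem).2.2⟩

/-- The reflection `ρ ↦ 1 − ρ̄` (i.e. `γ ↦ γ̄`) preserves the non-trivial zeros. [cite: Bombieri2000Weil, §8 (standing symmetries)] -/
theorem one_sub_conj_mem {ρ : ℂ} (h : ρ ∈ ZetaZeros.riemannZetaNontrivialZeros) :
    1 - conj ρ ∈ ZetaZeros.riemannZetaNontrivialZeros := by
  obtain ⟨h0, h1, h2⟩ := mem_riemannZetaNontrivialZeros_iff_holds.1 h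
  have hre : (1 - conj ρ).re = 1 - ρ.re := by simp
  refine mem_riemannZetaNontrivialZeros_iff_holds.2 ⟨?_, by rw [hre]; linarith, by rw [hre]; linarith⟩
  have hne : 1 - conj ρ ≠ 1 := by
    intro h'
    have : (1 - conj ρ).re = 1 := by rw [h']; simp
    rw [hre] at this; linarith
  have hpos : 0 < riemannZetaZeroOrder ρ :=
    (riemannZetaZeroOrder_pos_iff (by rintro rfl; simp at h2)).2 h0
  exact (riemannZetaZeroOrder_pos_iff hne).1 (by rwa [riemannZetaZeroOrder_one_sub_conj h1 h2])

/-- The index-level reflection `γ ↦ γ̄`: `(ρ, k) ↦ (1 − ρ̄, k)`, well defined because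
`m(1 − ρ̄) = m(ρ)` (`riemannZetaZeroOrder_one_sub_conj`). [cite: Bombieri2000Weil, §11 (11.3)–(11.4)] -/
def bar (i : ZeroIdx) : ZeroIdx :=
  ⟨⟨1 - conj i.val, one_sub_conj_mem i.val_mem⟩,
    Fin.cast (by rw [riemannZetaZeroOrder_one_sub_conj i.re_pos_and_lt_one.1 i.re_pos_and_lt_one.2]; rfl)
      i.2⟩

/-- The zero carried by the reflected slot is `1 − ρ̄`. [cite: Bombieri2000Weil, §11] -/
@[simp] theorem val_bar (i : ZeroIdx) : i.bar.val = 1 - conj i.val := rfl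

/-- On the index level `γ̄ = conj γ`. [cite: Bombieri2000Weil, §11] -/
theorem gamma_bar (i : ZeroIdx) : i.bar.gamma = conj i.gamma := by
  simp only [gamma, val_bar, map_mul, map_neg, Complex.conj_I, map_sub, map_one, map_div₀, map_ofNat]
  ring

/-- The truncation `Γ_N = Γ ∩ {|γ| ≤ N}` (§10), `|γ| = ‖ρ − 1/2‖`. [cite: Bombieri2000Weil, §10 (definition of Γ_N)] -/
def trunc (N : ℝ) : Set ZeroIdx := {i | ‖i.val - 1 / 2‖ ≤ N}

/-- `Γ_N` is finite (finitely many zeros of `ζ` in the disc `‖ρ − 1/2‖ ≤ N`,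
`IsCompact.inter_riemannZetaZeros_finite`, each of finite multiplicity), so the sums over `Γ_N` below
(`finsum`) are genuine finite sums. [cite: Bombieri2000Weil, §10 (definition of Γ_N)] -/
theorem trunc_finite (N : ℝ) : (trunc N).Finite := by
  have hB : {ρ : ZetaZeros.riemannZetaNontrivialZeros | ‖(ρ : ℂ) - 1 / 2‖ ≤ N}.Finite := by
    have h := (isCompact_closedBall (1 / 2 : ℂ) N).inter_riemannZetaZeros_finite
    refine (h.preimage Subtype.val_injective.injOn).subset ?_
    intro ρ hρ
    exact ⟨by simpa [Metric.mem_closedBall, dist_eq_norm] using hρ, ρ.2.1⟩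
  have hsub : trunc N ⊆ ⋃ ρ ∈ hB.toFinset, Set.range (Sigma.mk ρ) := by
    intro i hi
    simp only [Set.mem_iUnion, Set.Finite.mem_toFinset, Set.mem_setOf_eq, Set.mem_range]
    exact ⟨i.1, hi, i.2, rfl⟩
  exact (hB.toFinset.finite_toSet.biUnion fun ρ _ ↦ Set.finite_range (Sigma.mk ρ)).subset hsub

end ZeroIdx

/-! ## §6 Theorem 11 (§11) -/

/-- **Bombieri 2000, Theorem 11** (§11), for `ζ`, as printed (module docstring: statement and the
reading of "`F(u) = Σ_γ z_γ e^{−iγu}`"). Hypothesis: finitely many, but at least one, non-trivial zeros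
off the critical line (with multiplicity: finitely many slots). Conclusion, for every finite union of
bounded closed intervals `E ⊂ ℝ`: there are `z : Γ → ℂ`, `λ ≤ 0` and `F ∈ L²(E)` with
`Σ_γ |z_γ|² = 1`; `Σ_{γ∉ℝ} |z_γ|² ≥ −Re Σ_{γ∉ℝ} z_γ \overline{z_{γ̄}} ≥ 1/2`;
for every `γ ∈ Γ`, `λ z_γ = ∫_E e^{iγu} F(u) du = lim_N Σ_{γ'∈Γ_N} z_{γ'} ∫_E e^{iγu} e^{−iγ'u} du`;
and, with `g = 𝟙_E F` (Bombieri's `f(x) = φ(x) x^{−1/2} F(log x)` in the variable `u = log x`), either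
`W(g ⋆ g̃) = λ ∫_E |F|² < 0` or `λ = 0` and `F = 0` a.e. on `E`. Users take `(h : theorem11)`. [cite: Bombieri2000Weil, §11 Theorem 11] -/
def theorem11 : Prop :=
  {i : ZeroIdx | i.OffLine}.Finite → {i : ZeroIdx | i.OffLine}.Nonempty →
    ∀ (E : Set ℝ), IsFiniteUnionOfIntervals E →
      ∃ (z : ZeroIdx → ℂ) (lam : ℝ) (F : ℝ → ℂ),
        lam ≤ 0 ∧
        HasSum (fun i ↦ ‖z i‖ ^ 2) 1 ∧
        (1 / 2 : ℝ) ≤ -(∑' i : {i : ZeroIdx // i.OffLine}, z i * conj (z (i : ZeroIdx).bar)).re ∧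
        -(∑' i : {i : ZeroIdx // i.OffLine}, z i * conj (z (i : ZeroIdx).bar)).re ≤
          ∑' i : {i : ZeroIdx // i.OffLine}, ‖z i‖ ^ 2 ∧
        MemLp F 2 (volume.restrict E) ∧
        (∀ i : ZeroIdx,
          (lam : ℂ) * z i = ∫ u in E, cexp (I * i.gamma * u) * F u ∧
          Tendsto (fun N : ℕ ↦ ∑ᶠ j ∈ ZeroIdx.trunc N,
              z j * ∫ u in E, cexp (I * i.gamma * u) * cexp (-(I * j.gamma * u)))
            atTop (𝓝 ((lam : ℂ) * z i))) ∧
        ((weilQuadratic (E.indicator F) = (lam : ℂ) * ((∫ u in E, ‖F u‖ ^ 2 : ℝ) : ℂ) ∧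
            lam * ∫ u in E, ‖F u‖ ^ 2 < 0) ∨
          (lam = 0 ∧ F =ᵐ[volume.restrict E] 0))

/-! ## §7 The Corollary (§11) -/

/-- "`𝓔 ⊂ (0, ∞)` is a finite union of bounded closed intervals" (Corollary): a non-empty finite union
of non-degenerate intervals `[a, b]`, `0 < a < b`. [cite: Bombieri2000Weil, §11 Corollary] -/
def IsFiniteUnionOfPosIntervals (𝓔 : Set ℝ) : Prop :=
  ∃ s : Finset (ℝ × ℝ), s.Nonempty ∧ (∀ p ∈ s, 0 < p.1 ∧ p.1 < p.2) ∧ 𝓔 = ⋃ p ∈ s, Icc p.1 p.2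

/-- "The functions `x^{−ρ}` are linearly dependent over `𝓔` for the sequence of coefficients `c`", in
the sense established by Theorem 11 / Lemma 14 (module docstring): for every zero `ρ` (slot `i`),
`Σ_{ρ'} c_{ρ'} ∫_𝓔 x^{−ρ'} \overline{x^{−ρ}} dx = 0`, the series over `‖ρ' − 1/2‖ ≤ N` converging as
`N → ∞` (the formal sum `Σ c_{ρ'} x^{−ρ'}` is orthogonal in `L²(𝓔, dx)` to every `x^{−ρ}`). [cite: Bombieri2000Weil, §11 Corollary with (11.2) and Lemma 14] -/
def XPowLinDepOn (𝓔 : Set ℝ) (c : ZeroIdx → ℂ) : Prop :=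
  ∀ i : ZeroIdx,
    Tendsto (fun N : ℕ ↦ ∑ᶠ j ∈ ZeroIdx.trunc N,
        c j * ∫ x in 𝓔, (x : ℂ) ^ (-j.val) * conj ((x : ℂ) ^ (-i.val)))
      atTop (𝓝 0)

/-- **Bombieri 2000, Corollary to Theorem 11** (§11): "Let `𝓔 ⊂ (0, ∞)` be a finite union of bounded
closed intervals and suppose that `𝒯[f * f̄*] ≥ 0` for every smooth function `f` with compact support
in `𝓔`. Then either the Riemann Hypothesis is true, or `ζ(s)` has infinitely many zeros off the
critical line, or the functions `x^{−ρ}` are linearly dependent over `𝓔`, for a suitable sequence of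
coefficients `{c_ρ} ∈ ℓ²` such that at least half of its `ℓ²`-mass is supported on the set of zeros
`ρ` with `Re(ρ) ≠ 1/2`." The hypothesis is rendered in the tree's additive variable `u = log x`
(`IsWeilTest g`, `tsupport g ⊆ log 𝓔`, `0 ≤ Re (weilQuadratic g)`); the zeros are counted with
multiplicity (`ZeroIdx`), as Bombieri's `Γ`. Users take `(h : corollary11)`. [cite: Bombieri2000Weil, §11 Corollary] -/
def corollary11 : Prop :=
  ∀ (𝓔 : Set ℝ), IsFiniteUnionOfPosIntervals 𝓔 →
    (∀ g : ℝ → ℂ, IsWeilTest g → tsupport g ⊆ Real.log '' 𝓔 → 0 ≤ (weilQuadratic g).re) →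
      RiemannHypothesis ∨
        {ρ : ℂ | ρ ∈ ZetaZeros.riemannZetaNontrivialZeros ∧ ρ.re ≠ 1 / 2}.Infinite ∨
        ∃ c : ZeroIdx → ℂ, c ≠ 0 ∧ Summable (fun i ↦ ‖c i‖ ^ 2) ∧
          (∑' i, ‖c i‖ ^ 2) ≤ 2 * ∑' i : {i : ZeroIdx // i.OffLine}, ‖c i‖ ^ 2 ∧
          XPowLinDepOn 𝓔 c

/-! ## §8 Small API (sanity of the counting devices) -/

/-- A family of REAL numbers has no complex conjugate pairs. [cite: Bombieri2000Weil, §8 Lemma 10 (last clause)] -/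
theorem conjPairCount_eq_zero_of_im_eq_zero {ι : Type*} [Fintype ι] (γ : ι → ℂ)
    (h : ∀ i, (γ i).im = 0) : conjPairCount γ = 0 := by
  classical
  unfold conjPairCount
  rw [Finset.card_eq_zero, Finset.filter_eq_empty_iff]
  intro z hz
  obtain ⟨i, -, rfl⟩ := Finset.mem_image.1 hz
  simp [h i]

/-- The truncations `Γ_N` exhaust `Γ`. [cite: Bombieri2000Weil, §10 (definition of Γ_N)] -/
theorem ZeroIdx.mem_trunc_of_le {N : ℝ} {i : ZeroIdx} (h : ‖i.val - 1 / 2‖ ≤ N) :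
    i ∈ ZeroIdx.trunc N := h

/-- `Γ_N ⊆ Γ_{N'}` for `N ≤ N'`. [cite: Bombieri2000Weil, §10 (definition of Γ_N)] -/
theorem ZeroIdx.trunc_mono : Monotone ZeroIdx.trunc := fun _ _ h _ hi ↦ le_trans hi h

/-- Theorem 9 on a family of REAL `γ` (all `ρ` on the critical line): `𝒦_E(Γ)` has no negative
eigenvalue (Lemma 12, last clause, as a consequence of the fact). [cite: Bombieri2000Weil, §9 Lemma 12 and Theorem 9] -/
theorem theorem9.negEigenvalueCount_eq_zero_of_im_eq_zero (h : theorem9) {E : Set ℝ}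
    (hE : IsFiniteUnionOfIntervals E) {ι : Type} [Fintype ι] [DecidableEq ι] (γ : ι → ℂ)
    (hc : FamilyInvariant γ (starRingEnd ℂ)) (hn : FamilyInvariant γ (fun z ↦ -z))
    (hreal : ∀ i, (γ i).im = 0) : negEigenvalueCount (KMat E γ) = 0 := by
  rw [h.general hE γ hc hn, conjPairCount_eq_zero_of_im_eq_zero γ hreal]

/-! ## §9 Bridge to the tree's windows `[−a, a]` (`WeilPositivityOn a`) -/

/-- The dictionary `u = log x` on a symmetric window: `log [e^{−a}, e^{a}] = [−a, a]` (private helper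
for `corollary11.of_weilPositivityOn`). [folklore] -/
private theorem log_image_Icc_exp (a : ℝ) :
    Real.log '' Icc (Real.exp (-a)) (Real.exp a) = Icc (-a) a := by
  ext x
  constructor
  · rintro ⟨y, ⟨hy1, hy2⟩, rfl⟩
    have hy : 0 < y := (Real.exp_pos _).trans_le hy1
    exact ⟨by simpa using Real.log_le_log (Real.exp_pos _) hy1,
      by simpa using Real.log_le_log hy hy2⟩
  · rintro ⟨h1, h2⟩
    exact ⟨Real.exp x, ⟨Real.exp_le_exp.2 h1, Real.exp_le_exp.2 h2⟩, Real.log_exp x⟩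

/-- The window `𝓔 = [e^{−a}, e^{a}]`, `0 < a` (Bombieri's `[M⁻¹, M]`, `M = e^{a}`, §3–4), is a finite union
of bounded closed intervals in `(0, ∞)`. [cite: Bombieri2000Weil, §4 (the interval [M⁻¹, M]) and §11 Corollary] -/
theorem isFiniteUnionOfPosIntervals_Icc_exp {a : ℝ} (ha : 0 < a) :
    IsFiniteUnionOfPosIntervals (Icc (Real.exp (-a)) (Real.exp a)) := by
  refine ⟨{(Real.exp (-a), Real.exp a)}, Finset.singleton_nonempty _, ?_, ?_⟩
  · intro p hp
    rw [Finset.mem_singleton] at hp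
    subst hp
    exact ⟨Real.exp_pos _, Real.exp_lt_exp.2 (by linarith)⟩
  · simp

/-- The Corollary at a single window: a rung `WeilPositivityOn a` (`0 < a`; e.g. the tree's proved
`(log 3)/2`) is exactly the Corollary's hypothesis for `𝓔 = [e^{−a}, e^{a}]`, hence yields Bombieri's
trichotomy there: RH, or infinitely many zeros off the line, or an `ℓ²` linear dependence of the
`x^{−ρ}` over `[e^{−a}, e^{a}]` with at least half of its mass off the line. [cite: Bombieri2000Weil, §11 Corollary (case 𝓔 = [M⁻¹, M])] -/
theorem corollary11.of_weilPositivityOn (h : corollary11) {a : ℝ} (ha : 0 < a)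
    (hW : WeilPositivityOn a) :
    RiemannHypothesis ∨
      {ρ : ℂ | ρ ∈ ZetaZeros.riemannZetaNontrivialZeros ∧ ρ.re ≠ 1 / 2}.Infinite ∨
      ∃ c : ZeroIdx → ℂ, c ≠ 0 ∧ Summable (fun i ↦ ‖c i‖ ^ 2) ∧
        (∑' i, ‖c i‖ ^ 2) ≤ 2 * ∑' i : {i : ZeroIdx // i.OffLine}, ‖c i‖ ^ 2 ∧
        XPowLinDepOn (Icc (Real.exp (-a)) (Real.exp a)) c :=
  h _ (isFiniteUnionOfPosIntervals_Icc_exp ha) fun g hg hsupp ↦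
    hW g hg (by rwa [log_image_Icc_exp] at hsupp)

end Bombieri2000

end Literature.NumberTheory.LFunctions

end
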